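import Summits.QuantumFields.YangMills.Theorems.FluctuationComparisonRegPrIntLBackgroundFormCauchyGlobal
import Summits.QuantumFields.YangMills.Theorems.FluctuationComparisonRegPrIntLBackgroundFormResponseCauchy
import Summits.QuantumFields.YangMills.Theorems.FluctuationComparisonRegPrIntLBackgroundFormCellKnit
import HarnessLib

/-!
# THE ANALYTIC EDITION OF THE BACKGROUND FORM, v2 (COARSE CELLS): BOUNDED ANALYTIC TERMS ON A COLLAR ⇒ BGFORM∘ v2 (texts inline, def-free)

Cell `ym3-torus` (YM ladder rung R3 = continuum `SU(2)` Yang–Mills on the three-torus — a RUNG, NOT d = 4, NOT infinite volume, NOT a mass gap, NOT Clay).  Width seat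
`ym-ust-20520-w5` (gen 20); `--supports stmt-QuantumFields-20520 --as helper`, count-neutral, definition-free (row texts INLINE), default heartbeats.

WHAT.  Ideator `ym-r3-idea-1` g24's LINE g24-4 «background_form» was RE-TYPED to v2 after idea-crit-5 #496 (P1 «must-fix in types»): `Lines/background_form.lean`
22880983c54704f6 :156–205.  In v2 the terms `T X` are indexed by COARSE cells `X : Finset (PBond (F.P J) 0)`, the registers stay on the FINE bonds
(`M : window → PBond (F.P K) 0 → (Fin 8 → ℝ)`), a CELL MAP `blk : PBond (F.P K) 0 → PBond (F.P J) 0` sends registers to cells, the pseudo-metric `d` and every count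
live on the COARSE lattice (`K` enters no constant), and the term clauses are in CELL-SUM form with ARBITRARY register majorants: (t1)
`|T X (M U) − T X (M V)| ≤ ℓ X · Σ_{c∈X} S₁ c` whenever `‖M U e − M V e‖ ≤ S₁ (blk e)` on the blocks of `X`, (t2) the C¹·¹ analogue with `S₁ S₂ S₁₂`.  This is
SUP-NORM Lipschitz ∕ C¹·¹ on the registers of `blk⁻¹ X` — exactly the currency of this seat's GLOBAL COLLAR editions ✓`…CauchyGlobal.norm_sub_le_of_collar` ∕
`norm_c11_of_collar`.  THIS FILE is the v2 twin of this seat's `…BackgroundFormAnalyticKnit` (which docks on v1; imports: ✓`…CauchyGlobal`, ✓`…ResponseCauchy`, ✓(Hᵛ²) `…CellKnit` only):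
* **BGFORMᵃ∘ v2** (hypothesis of §1) = v2's text with FOUR changes, everything else VERBATIM: (1) one more uniform constant `Rₐ > 0` (Cauchy radius; print: `α₁` of
  (1.14)); (2) `(T ℓ h)` ↦ analytic data per cell set `X`: `𝒯 X : ({e ∕∕ blk e ∈ X} → ℂ⁸) → ℂ` on the COMPLEXIFIED registers of the blocks of `X`, a domain `Dom X`,
  an amplitude `Bx X ≥ 0` with v2's coarse pinned sums; (3) (t1)∕(t2) ↦ four analytic letters: `Dom X` OPEN (LEAD w3 g21's (D2)(a): holomorphy suppliers want it), `𝒯 X` complex-differentiable on `Dom X`, `‖𝒯 X‖ ≤ Bx X` there,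
  and the COLLAR `ball ((M U)|_{blk⁻¹X} ↪ ℂ⁸) (2Rₐ) ⊆ Dom X` for every window field `U` (sup norm); (4) representation through `Re 𝒯 X`.  `d, blk, M`, (d1)–(d5),
  (r1), (r2), `σ, σ₂` untouched.
* ★★★ `backgroundFormCell_of_analytic : ⟨BGFORMᵃ∘ v2⟩ → ⟨BGFORM∘ v2 VERBATIM⟩` with `T X u := Re 𝒯 X (u|_{blk⁻¹X} ↪ ℂ⁸)`, `ℓ X := 2·Bx X∕Rₐ`,
  `h X := 16·Bx X∕Rₐ²`, `A ↦ 2A∕Rₐ`, `Hc ↦ 16Hc∕Rₐ²`: (t1)∕(t2) for ALL window pairs∕quadruples and ALL register majorants by ✓`norm_sub_le_of_collar` ∕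
  ✓`norm_c11_of_collar` on the complexified restricted window image, plus `pi_norm_le_cellSum` (`‖f‖_sup ≤ Σ_{c∈X} S c` when `‖f e‖ ≤ S (blk e)`, `S ≥ 0`) and the
  isometry `ℝ⁸ ↪ ℂ⁸` ✓`…ResponseCauchy.pi_norm_ofReal_eq`.* ★★★ `fluctuationPartSmall_of_backgroundFormCellAnalytic : ⟨BGFORMᵃ∘ v2⟩ → ⟨S2β :412 VERBATIM⟩` and ★★★ `oneBondOscillation_of_backgroundFormCellAnalytic :
  ⟨BGFORMᵃ∘ v2⟩ → ⟨GRAD∘ VERBATIM⟩` — composition with w4-20520 g20's (Hᵛ²) ✓`…BackgroundFormCellKnit` (the v2 junction lift), by `exact`.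
NET (v2): WHY-FAIL (c) is a kernel theorem in v2's own types; BGFORMᵃ∘ v2 still ASKS of print the bounded analytic cell terms with (0.25)-small coarse pinned
amplitudes on a uniform collar (+ (a), (b), (d), (f) — see ✓`…ResponseCauchy` —, (g)); (r1)∕uniform-`C` SUSPENDED (#496b) — conditional plumbing, says nothing about them.

HONEST SCOPE.  Bookkeeping over ✓`…CauchyGlobal` ∕ ✓`…ResponseCauchy` ∕ ✓`…CellKnit`; nothing of Bałaban's analyticity, bounds or representation is asserted or proved; BGFORMᵃ∘ v2 ∕
BGFORM∘ v2 ∕ S2β ∕ GRAD∘ ∕ the five registered ∘-stubs (v11.4 0∕5, №36 intact) ∕ `FluctuationComparisonRegPrIntL` (20520) NOT proved; no summit is proved by a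
helper; rung R3 = SU(2) YM₃ on T³ — NOT d = 4, NOT infinite volume, NOT a mass gap, NOT Clay.  Sorry-free, axioms standard.

References: [Balaban1987RG1] CMP 109 (Thm 1 p.259; (0.22)–(0.25) pp.256–257; (1.11)–(1.14) p.262); [Balaban1988RG2Cluster] CMP 116 ((1.26) p.8); [Balaban1989LargeFieldII]
CMP 122 ((1.98)–(1.100) p.390); [Balaban1985Variational] CMP 102 (Prop. 9 p.309, (182)–(190) pp.307–308); [Balaban1985UV3] CMP 102 (Thm 2 p.263).
-/

set_option autoImplicit false

noncomputable section

namespace Summit.QuantumFields.YangMills.Theorems.FluctuationComparisonRegPrIntLBackgroundFormCellAnalyticKnit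

open MeasureTheory Filter Topology Set
open scoped BigOperators
open Literature.MathematicalPhysics.QuantumFieldTheory.Balaban1983to89
open Literature.MathematicalPhysics.QuantumFieldTheory.Balaban1983to89.T3ContinuumYM3Torus
open Literature.MathematicalPhysics.QuantumFieldTheory.Balaban1983to89.T3NestedUnitLaws
open Literature.MathematicalPhysics.QuantumFieldTheory.Balaban1983to89.T3UnitLawDensityEML
open Literature.MathematicalPhysics.QuantumFieldTheory.Balaban1983to89.T3UnitScaleTilt
open Literature.MathematicalPhysics.QuantumFieldTheory.Balaban1983to89.T3TiltDescent
open Literature.MathematicalPhysics.QuantumFieldTheory.Balaban1983to89.T3PrintedRegularMinimiser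
open Literature.MathematicalPhysics.QuantumFieldTheory.Balaban1983to89.T3LevelShift
open Literature.MathematicalPhysics.QuantumFieldTheory.Balaban1983to89.Missing
open Literature.MathematicalPhysics.QuantumFieldTheory.Balaban1983to89.T4Continuum
open Summit.QuantumFields.YangMills.Theorems.FluctuationComparisonRegPrIntLBackgroundFormCauchyShape
open Summit.QuantumFields.YangMills.Theorems.FluctuationComparisonRegPrIntLBackgroundFormCauchyGlobal
open Summit.QuantumFields.YangMills.Theorems.FluctuationComparisonRegPrIntLBackgroundFormResponseCauchy (pi_norm_ofReal_eq)
open Summit.QuantumFields.YangMills.Theorems.FluctuationComparisonRegPrIntLBackgroundFormCellKnit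

/-! ## §1 BGFORMᵃ∘ v2 → BGFORM∘ v2 -/

/-- Sup norm ≤ cell sum: if every register of a block family is bounded by the majorant of its cell, `‖f e‖ ≤ S (blk e)` with `S ≥ 0`, then
`‖f‖_sup ≤ Σ_{c∈X} S c`. [cite: Balaban1987RG1, (0.25) p.257] -/
theorem pi_norm_le_cellSum {Ef Ec W : Type*} [Fintype Ef] [DecidableEq Ec] [NormedAddCommGroup W] (blk : Ef → Ec) (X : Finset Ec) (S : Ec → ℝ) (hS : ∀ c, 0 ≤ S c)
    (f : {e : Ef // blk e ∈ X} → W) (hf : ∀ e : {e : Ef // blk e ∈ X}, ‖f e‖ ≤ S (blk e.1)) :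
    ‖f‖ ≤ ∑ c ∈ X, S c := by
  refine (pi_norm_le_iff_of_nonneg (Finset.sum_nonneg fun c _ => hS c)).mpr fun e => (hf e).trans ?_
  exact Finset.single_le_sum (f := S) (fun c _ => hS c) e.2

/-- ★★★ **BGFORMᵃ∘ v2 → BGFORM∘ v2.**  Hypothesis = **BGFORMᵃ∘ v2**, the ANALYTIC EDITION of LINE g24-4's v2 row (v2's text with `(T ℓ h)` and (t1)∕(t2) replaced by,
per coarse cell set `X`, a function `𝒯 X` on the complexified registers of the blocks of `X`, complex-differentiable and bounded by `Bx X` on an OPEN domain `Dom X` containing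
the uniform `2Rₐ`-collar of the embedded window registers, with v2's coarse pinned sums on `Bx`; representation through `Re 𝒯 X`; `d, blk, M`, the response clauses and
the moduli untouched); conclusion = BGFORM∘ v2 `FluctuationBackgroundFormCan` VERBATIM (`Lines/background_form.lean` 22880983c54704f6 :156–205) with
`T X u := Re 𝒯 X (u|_{blk⁻¹X} ↪ ℂ⁸)`, `ℓ X := 2·Bx X∕Rₐ`, `h X := 16·Bx X∕Rₐ²`, `A ↦ 2A∕Rₐ`, `Hc ↦ 16Hc∕Rₐ²`; (t1)∕(t2) by ✓`…CauchyGlobal.norm_sub_le_of_collar` ∕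
`norm_c11_of_collar` (sup norm, no smallness) + `pi_norm_le_cellSum`.
[cite: Balaban1987RG1, Thm 1 p.259, (0.22)-(0.25) pp.256-257 and (1.11)-(1.14) p.262; Balaban1988RG2Cluster, (1.26) p.8; Balaban1989LargeFieldII, (1.98)-(1.100) p.390; Balaban1985Variational, Prop. 9 p.309 and (182)-(190) pp.307-308] -/
theorem backgroundFormCell_of_analytic
    (hA :
        ∀ (L : ℕ), ∃ pS : ℝ, ∀ (b₀ p₀ : ℝ), 0 < b₀ → pS ≤ p₀ → 0 < p₀ → ∃ ε₁ : ℝ, 0 < ε₁ ∧ ∀ (ε₀ : ℝ), 0 < ε₀ → ε₀ ≤ ε₁ →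
          ∃ γ₁ : ℝ, 0 < γ₁ ∧ ∃ (κ μ C A Hc Rₐ : ℝ), 0 < κ ∧ 0 ≤ μ ∧ 0 ≤ A ∧ 0 ≤ Hc ∧ 0 < Rₐ ∧ ∀ (F : T3Family) (γ : ℝ), F.L = L → 0 < γ → γ ≤ γ₁ →
            ∃ (σ σ₂ : ℕ → ℝ), (∀ J, 0 ≤ σ J) ∧ (∀ J, 0 ≤ σ₂ J) ∧
              (∀ a : ℕ, Tendsto (fun J : ℕ => ((J : ℝ) + 1) ^ a * σ J) atTop (𝓝 0)) ∧
              (∀ a : ℕ, Tendsto (fun J : ℕ => ((J : ℝ) + 1) ^ a * σ₂ J) atTop (𝓝 0)) ∧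
              ∀ (ν : ℕ → (j : ℕ) → Measure (GaugeField (F.P j) 0 (Matrix.specialUnitaryGroup (Fin 2) ℂ))),
                (∀ K, ν K K = T4GenFunBounds.gibbsMeasure (F.P K) ((F.scheme ℰp γ).β K)) →
                (∀ K j, j < K → ν K j = Measure.map (descend F ℰp j) (ν K (j + 1))) →
                ∀ (J K : ℕ) (hJK : J ≤ K) (ρ : GaugeField (F.P J) 0 (Matrix.specialUnitaryGroup (Fin 2) ℂ) → ℝ),
                  (∀ U, PlaqSmall (θBal F.L γ b₀ p₀ J) U → 0 < ρ U) →
                  ν K J = (fieldMeasure _ _ _).withDensity (fun U => ENNReal.ofReal (ρ U)) →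
                  ContinuousOn ρ {U | PlaqSmall (θBal F.L γ b₀ p₀ J) U} →
                  ∃ (c₀ : ℝ) (d : PBond (F.P J) 0 → PBond (F.P J) 0 → ℝ) (blk : PBond (F.P K) 0 → PBond (F.P J) 0)
                    (M : GaugeField (F.P J) 0 (Matrix.specialUnitaryGroup (Fin 2) ℂ) → PBond (F.P K) 0 → (Fin 8 → ℝ))
                    (𝒯 : (X : Finset (PBond (F.P J) 0)) → (({e : PBond (F.P K) 0 // blk e ∈ X} → (Fin 8 → ℂ)) → ℂ))
                    (Dom : (X : Finset (PBond (F.P J) 0)) → Set ({e : PBond (F.P K) 0 // blk e ∈ X} → (Fin 8 → ℂ)))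
                    (Bx : Finset (PBond (F.P J) 0) → ℝ),
                    (∀ x y, 0 ≤ d x y) ∧ (∀ x y, d x y = d y x) ∧ (∀ x y z, d x z ≤ d x y + d y z) ∧
                    (∀ x, ∑ y, Real.exp (-(μ * d x y)) ≤ C) ∧
                    (∀ b b' : PBond (F.P J) 0, κ * (b.src.tdist b'.src : ℝ) ≤ μ * d b b') ∧
                    (∀ X, 0 ≤ Bx X) ∧
                    (∀ c, ∑ X ∈ Finset.univ.filter (fun X => c ∈ X), Bx X ≤ A) ∧
                    (∀ c c', ∑ X ∈ Finset.univ.filter (fun X => c ∈ X ∧ c' ∈ X), Bx X ≤ Hc * Real.exp (-(2 * μ * d c c'))) ∧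
                    (∀ X, IsOpen (Dom X)) ∧ (∀ X, DifferentiableOn ℂ (𝒯 X) (Dom X)) ∧
                    (∀ X, ∀ p ∈ Dom X, ‖𝒯 X p‖ ≤ Bx X) ∧
                    (∀ (X : Finset (PBond (F.P J) 0)) (U : GaugeField (F.P J) 0 (Matrix.specialUnitaryGroup (Fin 2) ℂ)),
                        PlaqSmall (θBal F.L γ b₀ p₀ J) U →
                        Metric.ball (fun (e : {e : PBond (F.P K) 0 // blk e ∈ X}) (i : Fin 8) => (M U e.1 i : ℂ)) (2 * Rₐ) ⊆ Dom X) ∧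
                    (∀ (b : PBond (F.P J) 0) (U V : GaugeField (F.P J) 0 (Matrix.specialUnitaryGroup (Fin 2) ℂ)),
                        PlaqSmall (θBal F.L γ b₀ p₀ J) U → PlaqSmall (θBal F.L γ b₀ p₀ J) V → (∀ e, e ≠ b → U e = V e) →
                        ∀ e, ‖M U e - M V e‖ ≤ σ J * Real.exp (-(2 * μ * d b (blk e)))) ∧
                    (∀ (b b' : PBond (F.P J) 0) (U V W Z : GaugeField (F.P J) 0 (Matrix.specialUnitaryGroup (Fin 2) ℂ)),
                        PlaqSmall (θBal F.L γ b₀ p₀ J) U → PlaqSmall (θBal F.L γ b₀ p₀ J) V →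
                        PlaqSmall (θBal F.L γ b₀ p₀ J) W → PlaqSmall (θBal F.L γ b₀ p₀ J) Z →
                        (∀ e, e ≠ b → U e = V e) → (∀ e, e ≠ b' → U e = W e) → (∀ e, e ≠ b' → V e = Z e) → (∀ e, e ≠ b → W e = Z e) →
                        ∀ e, ‖M U e - M W e - M V e + M Z e‖ ≤
                          σ₂ J * (Real.exp (-(2 * μ * d b (blk e))) * Real.exp (-(2 * μ * d (blk e) b')))) ∧
                    (∀ U : GaugeField (F.P J) 0 (Matrix.specialUnitaryGroup (Fin 2) ℂ), PlaqSmall (θBal F.L γ b₀ p₀ J) U →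
                        Real.log (ρ U) + (F.scheme ℰp γ).β K * minActionRegPr F J K hJK ε₀ U = c₀ + ∑ X, (𝒯 X (fun (e : {e : PBond (F.P K) 0 // blk e ∈ X}) (i : Fin 8) => (M U e.1 i : ℂ))).re)) :
      ∀ (L : ℕ), ∃ pS : ℝ, ∀ (b₀ p₀ : ℝ), 0 < b₀ → pS ≤ p₀ → 0 < p₀ → ∃ ε₁ : ℝ, 0 < ε₁ ∧ ∀ (ε₀ : ℝ), 0 < ε₀ → ε₀ ≤ ε₁ →
        ∃ γ₁ : ℝ, 0 < γ₁ ∧ ∃ (κ μ C A Hc : ℝ), 0 < κ ∧ 0 ≤ μ ∧ 0 ≤ A ∧ 0 ≤ Hc ∧ ∀ (F : T3Family) (γ : ℝ), F.L = L → 0 < γ → γ ≤ γ₁ →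
          ∃ (σ σ₂ : ℕ → ℝ), (∀ J, 0 ≤ σ J) ∧ (∀ J, 0 ≤ σ₂ J) ∧
            (∀ a : ℕ, Tendsto (fun J : ℕ => ((J : ℝ) + 1) ^ a * σ J) atTop (𝓝 0)) ∧
            (∀ a : ℕ, Tendsto (fun J : ℕ => ((J : ℝ) + 1) ^ a * σ₂ J) atTop (𝓝 0)) ∧
            ∀ (ν : ℕ → (j : ℕ) → Measure (GaugeField (F.P j) 0 (Matrix.specialUnitaryGroup (Fin 2) ℂ))),
              (∀ K, ν K K = T4GenFunBounds.gibbsMeasure (F.P K) ((F.scheme ℰp γ).β K)) →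
              (∀ K j, j < K → ν K j = Measure.map (descend F ℰp j) (ν K (j + 1))) →
              ∀ (J K : ℕ) (hJK : J ≤ K) (ρ : GaugeField (F.P J) 0 (Matrix.specialUnitaryGroup (Fin 2) ℂ) → ℝ),
                (∀ U, PlaqSmall (θBal F.L γ b₀ p₀ J) U → 0 < ρ U) →
                ν K J = (fieldMeasure _ _ _).withDensity (fun U => ENNReal.ofReal (ρ U)) →
                ContinuousOn ρ {U | PlaqSmall (θBal F.L γ b₀ p₀ J) U} →
                ∃ (c₀ : ℝ) (d : PBond (F.P J) 0 → PBond (F.P J) 0 → ℝ) (blk : PBond (F.P K) 0 → PBond (F.P J) 0)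
                  (M : GaugeField (F.P J) 0 (Matrix.specialUnitaryGroup (Fin 2) ℂ) → PBond (F.P K) 0 → (Fin 8 → ℝ))
                  (T : Finset (PBond (F.P J) 0) → (PBond (F.P K) 0 → (Fin 8 → ℝ)) → ℝ)
                  (ℓ h : Finset (PBond (F.P J) 0) → ℝ),
                  (∀ x y, 0 ≤ d x y) ∧ (∀ x y, d x y = d y x) ∧ (∀ x y z, d x z ≤ d x y + d y z) ∧
                  (∀ x, ∑ y, Real.exp (-(μ * d x y)) ≤ C) ∧
                  (∀ b b' : PBond (F.P J) 0, κ * (b.src.tdist b'.src : ℝ) ≤ μ * d b b') ∧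
                  (∀ X, 0 ≤ ℓ X) ∧ (∀ X, 0 ≤ h X) ∧
                  (∀ c, ∑ X ∈ Finset.univ.filter (fun X => c ∈ X), ℓ X ≤ A) ∧
                  (∀ c c', ∑ X ∈ Finset.univ.filter (fun X => c ∈ X ∧ c' ∈ X), h X ≤ Hc * Real.exp (-(2 * μ * d c c'))) ∧
                  (∀ (X : Finset (PBond (F.P J) 0)) (U V : GaugeField (F.P J) 0 (Matrix.specialUnitaryGroup (Fin 2) ℂ)),
                      PlaqSmall (θBal F.L γ b₀ p₀ J) U → PlaqSmall (θBal F.L γ b₀ p₀ J) V →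
                      ∀ (S₁ : PBond (F.P J) 0 → ℝ), (∀ c, 0 ≤ S₁ c) →
                      (∀ e, blk e ∈ X → ‖M U e - M V e‖ ≤ S₁ (blk e)) →
                      |T X (M U) - T X (M V)| ≤ ℓ X * ∑ c ∈ X, S₁ c) ∧
                  (∀ (X : Finset (PBond (F.P J) 0)) (U V W Z : GaugeField (F.P J) 0 (Matrix.specialUnitaryGroup (Fin 2) ℂ)),
                      PlaqSmall (θBal F.L γ b₀ p₀ J) U → PlaqSmall (θBal F.L γ b₀ p₀ J) V →
                      PlaqSmall (θBal F.L γ b₀ p₀ J) W → PlaqSmall (θBal F.L γ b₀ p₀ J) Z →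
                      ∀ (S₁ S₂ S₁₂ : PBond (F.P J) 0 → ℝ), (∀ c, 0 ≤ S₁ c) → (∀ c, 0 ≤ S₂ c) → (∀ c, 0 ≤ S₁₂ c) →
                      (∀ e, blk e ∈ X → ‖M W e - M Z e‖ ≤ S₁ (blk e)) →
                      (∀ e, blk e ∈ X → ‖M V e - M Z e‖ ≤ S₂ (blk e)) →
                      (∀ e, blk e ∈ X → ‖M U e - M W e - M V e + M Z e‖ ≤ S₁₂ (blk e)) →
                      |T X (M U) - T X (M W) - T X (M V) + T X (M Z)| ≤
                        h X * (∑ c ∈ X, S₁ c) * (∑ c ∈ X, S₂ c) + ℓ X * ∑ c ∈ X, S₁₂ c) ∧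
                  (∀ (b : PBond (F.P J) 0) (U V : GaugeField (F.P J) 0 (Matrix.specialUnitaryGroup (Fin 2) ℂ)),
                      PlaqSmall (θBal F.L γ b₀ p₀ J) U → PlaqSmall (θBal F.L γ b₀ p₀ J) V → (∀ e, e ≠ b → U e = V e) →
                      ∀ e, ‖M U e - M V e‖ ≤ σ J * Real.exp (-(2 * μ * d b (blk e)))) ∧
                  (∀ (b b' : PBond (F.P J) 0) (U V W Z : GaugeField (F.P J) 0 (Matrix.specialUnitaryGroup (Fin 2) ℂ)),
                      PlaqSmall (θBal F.L γ b₀ p₀ J) U → PlaqSmall (θBal F.L γ b₀ p₀ J) V →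
                      PlaqSmall (θBal F.L γ b₀ p₀ J) W → PlaqSmall (θBal F.L γ b₀ p₀ J) Z →
                      (∀ e, e ≠ b → U e = V e) → (∀ e, e ≠ b' → U e = W e) → (∀ e, e ≠ b' → V e = Z e) → (∀ e, e ≠ b → W e = Z e) →
                      ∀ e, ‖M U e - M W e - M V e + M Z e‖ ≤
                        σ₂ J * (Real.exp (-(2 * μ * d b (blk e))) * Real.exp (-(2 * μ * d (blk e) b')))) ∧
                  (∀ U : GaugeField (F.P J) 0 (Matrix.specialUnitaryGroup (Fin 2) ℂ), PlaqSmall (θBal F.L γ b₀ p₀ J) U →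
                      Real.log (ρ U) + (F.scheme ℰp γ).β K * minActionRegPr F J K hJK ε₀ U = c₀ + ∑ X, T X (M U)) := by
  intro L
  obtain ⟨pS, HpS⟩ := hA L
  refine ⟨pS, ?_⟩
  intro b₀ p₀ hb₀ hpS hp₀
  obtain ⟨ε₁, hε₁, Hε⟩ := HpS b₀ p₀ hb₀ hpS hp₀
  refine ⟨ε₁, hε₁, ?_⟩
  intro ε₀ hε₀ hε₀₁
  obtain ⟨γ₁, hγ₁, κ, μ, C, A, Hc, Rₐ, hκ, hμ, hA0, hHc, hRₐ, HF⟩ := Hε ε₀ hε₀ hε₀₁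
  refine ⟨γ₁, hγ₁, κ, μ, C, 2 * A / Rₐ, 16 * Hc / Rₐ ^ 2, hκ, hμ, by positivity, by positivity, ?_⟩
  intro F γ hFL hγ hγ₁'
  obtain ⟨σ, σ₂, hσ0, hσ₂0, hσ, hσ₂, Hν⟩ := HF F γ hFL hγ hγ₁'
  refine ⟨σ, σ₂, hσ0, hσ₂0, hσ, hσ₂, ?_⟩
  intro ν hνK hνd J K hJK ρ hρpos hρν hρcont
  obtain ⟨c₀, d, blk, M, 𝒯, Dom, Bx, hd0, hdsym, hdtri, hdsum, hdcmp, hBx0, hpin1, hpin2, _hopen, hana, hbdd, hcol, hsens1, hsens2, hrep⟩ :=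
    Hν ν hνK hνd J K hJK ρ hρpos hρν hρcont
  have h2R : 0 < 2 * Rₐ := by linarith
  -- the coordinatewise embedding `ℝ⁸ ↪ ℂ⁸` is isometric for the sup norm (✓`…ResponseCauchy.pi_norm_ofReal_eq`), hence:
  have hsub : ∀ x y : Fin 8 → ℝ, ‖(fun i => (x i : ℂ)) - (fun i => (y i : ℂ))‖ ≤ ‖x - y‖ := fun x y => by
    have hxy : (fun i => (x i : ℂ)) - (fun i => (y i : ℂ)) = fun i => ((x - y) i : ℂ) := by
      funext i; simp [Complex.ofReal_sub]
    rw [hxy, pi_norm_ofReal_eq]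
  have hsub4 : ∀ x y z w : Fin 8 → ℝ,
      ‖(fun i => (x i : ℂ)) - (fun i => (y i : ℂ)) - (fun i => (z i : ℂ)) + (fun i => (w i : ℂ))‖ ≤ ‖x - y - z + w‖ := fun x y z w => by
    have hxy : (fun i => (x i : ℂ)) - (fun i => (y i : ℂ)) - (fun i => (z i : ℂ)) + (fun i => (w i : ℂ)) = fun i => ((x - y - z + w) i : ℂ) := by
      funext i; simp [Complex.ofReal_sub, Complex.ofReal_add]
    rw [hxy, pi_norm_ofReal_eq]
  -- the complexified restricted window image per cell set `X`, and its collar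
  have memcol : ∀ (X : Finset (PBond (F.P J) 0)) (U : GaugeField (F.P J) 0 (Matrix.specialUnitaryGroup (Fin 2) ℂ)),
      PlaqSmall (θBal F.L γ b₀ p₀ J) U →
      (fun (e : {e : PBond (F.P K) 0 // blk e ∈ X}) (i : Fin 8) => (M U e.1 i : ℂ)) ∈
        {w : {e : PBond (F.P K) 0 // blk e ∈ X} → (Fin 8 → ℂ) |
          ∃ U' : GaugeField (F.P J) 0 (Matrix.specialUnitaryGroup (Fin 2) ℂ), PlaqSmall (θBal F.L γ b₀ p₀ J) U' ∧
            w = fun (e : {e : PBond (F.P K) 0 // blk e ∈ X}) (i : Fin 8) => (M U' e.1 i : ℂ)} :=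
    fun X U hU => ⟨U, hU, rfl⟩
  have hcol' : ∀ (X : Finset (PBond (F.P J) 0)),
      ∀ w ∈ {w : {e : PBond (F.P K) 0 // blk e ∈ X} → (Fin 8 → ℂ) |
          ∃ U' : GaugeField (F.P J) 0 (Matrix.specialUnitaryGroup (Fin 2) ℂ), PlaqSmall (θBal F.L γ b₀ p₀ J) U' ∧
            w = fun (e : {e : PBond (F.P K) 0 // blk e ∈ X}) (i : Fin 8) => (M U' e.1 i : ℂ)},
        Metric.ball w (2 * Rₐ) ⊆ Dom X := by
    rintro X w ⟨U', hU', rfl⟩; exact hcol X U' hU'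
  refine ⟨c₀, d, blk, M, fun X u => (𝒯 X (fun (e : {e : PBond (F.P K) 0 // blk e ∈ X}) (i : Fin 8) => (u e.1 i : ℂ))).re,
    fun X => 2 * Bx X / Rₐ, fun X => 16 * Bx X / Rₐ ^ 2, hd0, hdsym, hdtri, hdsum, hdcmp,
    fun X => by have := hBx0 X; positivity, fun X => by have := hBx0 X; positivity, ?_, ?_, ?_, ?_, hsens1, hsens2, ?_⟩
  · -- one-pin sum of `ℓ` on the coarse lattice
    intro c
    have h := hpin1 c
    calc ∑ X ∈ Finset.univ.filter (fun X => c ∈ X), 2 * Bx X / Rₐ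
        = 2 * (∑ X ∈ Finset.univ.filter (fun X => c ∈ X), Bx X) / Rₐ := by rw [Finset.mul_sum, Finset.sum_div]
      _ ≤ 2 * A / Rₐ := div_le_div_of_nonneg_right (by linarith) hRₐ.le
  · -- two-pin sum of `h` on the coarse lattice
    intro c c'
    have h := hpin2 c c'
    calc ∑ X ∈ Finset.univ.filter (fun X => c ∈ X ∧ c' ∈ X), 16 * Bx X / Rₐ ^ 2
        = 16 * (∑ X ∈ Finset.univ.filter (fun X => c ∈ X ∧ c' ∈ X), Bx X) / Rₐ ^ 2 := by rw [Finset.mul_sum, Finset.sum_div]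
      _ ≤ 16 * (Hc * Real.exp (-(2 * μ * d c c'))) / Rₐ ^ 2 := div_le_div_of_nonneg_right (by linarith) (by positivity)
      _ = 16 * Hc / Rₐ ^ 2 * Real.exp (-(2 * μ * d c c')) := by ring
  · -- (t1): cell-sum Lipschitz for ALL window pairs and ALL register majorants, by the collar
    intro X U V hU hV S₁ hS₁ hreg
    have hB := hBx0 X
    have key := norm_sub_le_of_collar (hana X) (hbdd X) hRₐ (hcol' X) (memcol X U hU) (memcol X V hV)
    have hsup : ‖(fun (e : {e : PBond (F.P K) 0 // blk e ∈ X}) (i : Fin 8) => (M U e.1 i : ℂ)) -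
        (fun (e : {e : PBond (F.P K) 0 // blk e ∈ X}) (i : Fin 8) => (M V e.1 i : ℂ))‖ ≤ ∑ c ∈ X, S₁ c := by
      refine pi_norm_le_cellSum blk X S₁ hS₁ _ fun e => ?_
      exact (hsub (M U e.1) (M V e.1)).trans (hreg e.1 e.2)
    have hS : 0 ≤ ∑ c ∈ X, S₁ c := Finset.sum_nonneg fun c _ => hS₁ c
    calc |(𝒯 X (fun (e : {e : PBond (F.P K) 0 // blk e ∈ X}) (i : Fin 8) => (M U e.1 i : ℂ))).re -
          (𝒯 X (fun (e : {e : PBond (F.P K) 0 // blk e ∈ X}) (i : Fin 8) => (M V e.1 i : ℂ))).re|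
        ≤ ‖𝒯 X (fun (e : {e : PBond (F.P K) 0 // blk e ∈ X}) (i : Fin 8) => (M U e.1 i : ℂ)) -
            𝒯 X (fun (e : {e : PBond (F.P K) 0 // blk e ∈ X}) (i : Fin 8) => (M V e.1 i : ℂ))‖ := by
          rw [← Complex.sub_re]; exact Complex.abs_re_le_norm _
      _ ≤ Bx X / Rₐ * ∑ c ∈ X, S₁ c := key.trans (mul_le_mul_of_nonneg_left hsup (by positivity))
      _ ≤ 2 * Bx X / Rₐ * ∑ c ∈ X, S₁ c := mul_le_mul_of_nonneg_right (div_le_div_of_nonneg_right (by linarith) hRₐ.le) hS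
  · -- (t2): cell-sum C¹·¹ for ALL window quadruples and ALL register majorants (corners `u₀₀ := Z, u₁₀ := W, u₀₁ := V, u₁₁ := U`)
    intro X U V W Z hU hV hW hZ S₁ S₂ S₁₂ hS₁ hS₂ hS₁₂ hreg₁ hreg₂ hreg₁₂
    dsimp only
    have hB := hBx0 X
    set rU : {e : PBond (F.P K) 0 // blk e ∈ X} → (Fin 8 → ℂ) := fun e i => (M U e.1 i : ℂ) with hrU
    set rV : {e : PBond (F.P K) 0 // blk e ∈ X} → (Fin 8 → ℂ) := fun e i => (M V e.1 i : ℂ) with hrV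
    set rW : {e : PBond (F.P K) 0 // blk e ∈ X} → (Fin 8 → ℂ) := fun e i => (M W e.1 i : ℂ) with hrW
    set rZ : {e : PBond (F.P K) 0 // blk e ∈ X} → (Fin 8 → ℂ) := fun e i => (M Z e.1 i : ℂ) with hrZ
    have key := norm_c11_of_collar (hana X) (hbdd X) hRₐ (hcol' X)
      (memcol X Z hZ) (memcol X W hW) (memcol X V hV) (memcol X U hU)
    have n₁ : ‖rW - rZ‖ ≤ ∑ c ∈ X, S₁ c :=
      pi_norm_le_cellSum blk X S₁ hS₁ _ fun e => (hsub (M W e.1) (M Z e.1)).trans (hreg₁ e.1 e.2)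
    have n₂ : ‖rV - rZ‖ ≤ ∑ c ∈ X, S₂ c :=
      pi_norm_le_cellSum blk X S₂ hS₂ _ fun e => (hsub (M V e.1) (M Z e.1)).trans (hreg₂ e.1 e.2)
    have n₁₂ : ‖rU - rW - rV + rZ‖ ≤ ∑ c ∈ X, S₁₂ c :=
      pi_norm_le_cellSum blk X S₁₂ hS₁₂ _ fun e =>
        (hsub4 (M U e.1) (M W e.1) (M V e.1) (M Z e.1)).trans (hreg₁₂ e.1 e.2)
    have hc₁ : 0 ≤ 16 * Bx X / Rₐ ^ 2 := by positivity
    have hc₂ : 0 ≤ 2 * Bx X / Rₐ := by positivity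
    have hmix : 16 * Bx X / Rₐ ^ 2 * (‖rW - rZ‖ * ‖rV - rZ‖) ≤ 16 * Bx X / Rₐ ^ 2 * (∑ c ∈ X, S₁ c) * (∑ c ∈ X, S₂ c) := by
      rw [mul_assoc]
      exact mul_le_mul_of_nonneg_left (mul_le_mul n₁ n₂ (norm_nonneg _) ((norm_nonneg _).trans n₁)) hc₁
    have hdef : 2 * Bx X / Rₐ * ‖rU - rW - rV + rZ‖ ≤ 2 * Bx X / Rₐ * ∑ c ∈ X, S₁₂ c := mul_le_mul_of_nonneg_left n₁₂ hc₂
    refine le_trans ?_ (key.trans (add_le_add hmix hdef))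
    rw [← Complex.sub_re, ← Complex.sub_re, ← Complex.add_re]
    exact Complex.abs_re_le_norm _
  · -- representation
    intro U hU
    exact hrep U hU


/-! ## §2 BGFORMᵃ∘ v2 → S2β and BGFORMᵃ∘ v2 → GRAD∘ (composition with w4-20520 g20's ✓`…BackgroundFormCellKnit`) -/

/-- ★★★ **BGFORMᵃ∘ v2 → S2β.**  Hypothesis = BGFORMᵃ∘ v2 (§1); conclusion = the PATH-B organ S2β `FluctuationPartSmall` (registry `Lines/semiclassical_s2beta.lean`
v11.4 :412 VERBATIM, normalised sha16 e30624f0b884478a): `fluctuationPartSmall_of_backgroundFormCell ∘ backgroundFormCell_of_analytic`.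
[cite: Balaban1985UV3, Thm 2 p.263 and (41) p.266; Balaban1987RG1, (0.22)-(0.25) pp.256-257 and (1.11)-(1.14) p.262; Balaban1989LargeFieldII, (1.98)-(1.100) p.390; Balaban1985Variational, Prop. 9 p.309] -/
theorem fluctuationPartSmall_of_backgroundFormCellAnalytic
    (hA :
        ∀ (L : ℕ), ∃ pS : ℝ, ∀ (b₀ p₀ : ℝ), 0 < b₀ → pS ≤ p₀ → 0 < p₀ → ∃ ε₁ : ℝ, 0 < ε₁ ∧ ∀ (ε₀ : ℝ), 0 < ε₀ → ε₀ ≤ ε₁ →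
          ∃ γ₁ : ℝ, 0 < γ₁ ∧ ∃ (κ μ C A Hc Rₐ : ℝ), 0 < κ ∧ 0 ≤ μ ∧ 0 ≤ A ∧ 0 ≤ Hc ∧ 0 < Rₐ ∧ ∀ (F : T3Family) (γ : ℝ), F.L = L → 0 < γ → γ ≤ γ₁ →
            ∃ (σ σ₂ : ℕ → ℝ), (∀ J, 0 ≤ σ J) ∧ (∀ J, 0 ≤ σ₂ J) ∧
              (∀ a : ℕ, Tendsto (fun J : ℕ => ((J : ℝ) + 1) ^ a * σ J) atTop (𝓝 0)) ∧
              (∀ a : ℕ, Tendsto (fun J : ℕ => ((J : ℝ) + 1) ^ a * σ₂ J) atTop (𝓝 0)) ∧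
              ∀ (ν : ℕ → (j : ℕ) → Measure (GaugeField (F.P j) 0 (Matrix.specialUnitaryGroup (Fin 2) ℂ))),
                (∀ K, ν K K = T4GenFunBounds.gibbsMeasure (F.P K) ((F.scheme ℰp γ).β K)) →
                (∀ K j, j < K → ν K j = Measure.map (descend F ℰp j) (ν K (j + 1))) →
                ∀ (J K : ℕ) (hJK : J ≤ K) (ρ : GaugeField (F.P J) 0 (Matrix.specialUnitaryGroup (Fin 2) ℂ) → ℝ),
                  (∀ U, PlaqSmall (θBal F.L γ b₀ p₀ J) U → 0 < ρ U) →
                  ν K J = (fieldMeasure _ _ _).withDensity (fun U => ENNReal.ofReal (ρ U)) →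
                  ContinuousOn ρ {U | PlaqSmall (θBal F.L γ b₀ p₀ J) U} →
                  ∃ (c₀ : ℝ) (d : PBond (F.P J) 0 → PBond (F.P J) 0 → ℝ) (blk : PBond (F.P K) 0 → PBond (F.P J) 0)
                    (M : GaugeField (F.P J) 0 (Matrix.specialUnitaryGroup (Fin 2) ℂ) → PBond (F.P K) 0 → (Fin 8 → ℝ))
                    (𝒯 : (X : Finset (PBond (F.P J) 0)) → (({e : PBond (F.P K) 0 // blk e ∈ X} → (Fin 8 → ℂ)) → ℂ))
                    (Dom : (X : Finset (PBond (F.P J) 0)) → Set ({e : PBond (F.P K) 0 // blk e ∈ X} → (Fin 8 → ℂ)))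
                    (Bx : Finset (PBond (F.P J) 0) → ℝ),
                    (∀ x y, 0 ≤ d x y) ∧ (∀ x y, d x y = d y x) ∧ (∀ x y z, d x z ≤ d x y + d y z) ∧
                    (∀ x, ∑ y, Real.exp (-(μ * d x y)) ≤ C) ∧
                    (∀ b b' : PBond (F.P J) 0, κ * (b.src.tdist b'.src : ℝ) ≤ μ * d b b') ∧
                    (∀ X, 0 ≤ Bx X) ∧
                    (∀ c, ∑ X ∈ Finset.univ.filter (fun X => c ∈ X), Bx X ≤ A) ∧
                    (∀ c c', ∑ X ∈ Finset.univ.filter (fun X => c ∈ X ∧ c' ∈ X), Bx X ≤ Hc * Real.exp (-(2 * μ * d c c'))) ∧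
                    (∀ X, IsOpen (Dom X)) ∧ (∀ X, DifferentiableOn ℂ (𝒯 X) (Dom X)) ∧
                    (∀ X, ∀ p ∈ Dom X, ‖𝒯 X p‖ ≤ Bx X) ∧
                    (∀ (X : Finset (PBond (F.P J) 0)) (U : GaugeField (F.P J) 0 (Matrix.specialUnitaryGroup (Fin 2) ℂ)),
                        PlaqSmall (θBal F.L γ b₀ p₀ J) U →
                        Metric.ball (fun (e : {e : PBond (F.P K) 0 // blk e ∈ X}) (i : Fin 8) => (M U e.1 i : ℂ)) (2 * Rₐ) ⊆ Dom X) ∧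
                    (∀ (b : PBond (F.P J) 0) (U V : GaugeField (F.P J) 0 (Matrix.specialUnitaryGroup (Fin 2) ℂ)),
                        PlaqSmall (θBal F.L γ b₀ p₀ J) U → PlaqSmall (θBal F.L γ b₀ p₀ J) V → (∀ e, e ≠ b → U e = V e) →
                        ∀ e, ‖M U e - M V e‖ ≤ σ J * Real.exp (-(2 * μ * d b (blk e)))) ∧
                    (∀ (b b' : PBond (F.P J) 0) (U V W Z : GaugeField (F.P J) 0 (Matrix.specialUnitaryGroup (Fin 2) ℂ)),
                        PlaqSmall (θBal F.L γ b₀ p₀ J) U → PlaqSmall (θBal F.L γ b₀ p₀ J) V →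
                        PlaqSmall (θBal F.L γ b₀ p₀ J) W → PlaqSmall (θBal F.L γ b₀ p₀ J) Z →
                        (∀ e, e ≠ b → U e = V e) → (∀ e, e ≠ b' → U e = W e) → (∀ e, e ≠ b' → V e = Z e) → (∀ e, e ≠ b → W e = Z e) →
                        ∀ e, ‖M U e - M W e - M V e + M Z e‖ ≤
                          σ₂ J * (Real.exp (-(2 * μ * d b (blk e))) * Real.exp (-(2 * μ * d (blk e) b')))) ∧
                    (∀ U : GaugeField (F.P J) 0 (Matrix.specialUnitaryGroup (Fin 2) ℂ), PlaqSmall (θBal F.L γ b₀ p₀ J) U →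
                        Real.log (ρ U) + (F.scheme ℰp γ).β K * minActionRegPr F J K hJK ε₀ U = c₀ + ∑ X, (𝒯 X (fun (e : {e : PBond (F.P K) 0 // blk e ∈ X}) (i : Fin 8) => (M U e.1 i : ℂ))).re)) :
      ∀ (L : ℕ), ∃ pS : ℝ, ∀ (b₀ p₀ : ℝ), 0 < b₀ → pS ≤ p₀ → 0 < p₀ → ∃ ε₁ : ℝ, 0 < ε₁ ∧ ∀ (ε₀ : ℝ), 0 < ε₀ → ε₀ ≤ ε₁ →
        ∃ γ₁ : ℝ, 0 < γ₁ ∧ ∃ κ : ℝ, 0 < κ ∧ ∀ (F : T3Family) (γ : ℝ), F.L = L → 0 < γ → γ ≤ γ₁ →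
          ∃ (φ : ℕ → ℝ), (∀ J, 0 ≤ φ J) ∧ Tendsto (fun J : ℕ => (J : ℝ) * φ J) atTop (𝓝 0) ∧
            ∀ (ν : ℕ → (j : ℕ) → Measure (GaugeField (F.P j) 0 (Matrix.specialUnitaryGroup (Fin 2) ℂ))),
              (∀ K, ν K K = T4GenFunBounds.gibbsMeasure (F.P K) ((F.scheme ℰp γ).β K)) →
              (∀ K j, j < K → ν K j = Measure.map (descend F ℰp j) (ν K (j + 1))) →
              ∀ (J K : ℕ) (hJK : J ≤ K) (ρ : GaugeField (F.P J) 0 (Matrix.specialUnitaryGroup (Fin 2) ℂ) → ℝ),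
                (∀ U, PlaqSmall (θBal F.L γ b₀ p₀ J) U → 0 < ρ U) →
                ν K J = (fieldMeasure _ _ _).withDensity (fun U => ENNReal.ofReal (ρ U)) →
                ContinuousOn ρ {U | PlaqSmall (θBal F.L γ b₀ p₀ J) U} →
                ∀ (b b' : PBond (F.P J) 0) (U V W Z : GaugeField (F.P J) 0 (Matrix.specialUnitaryGroup (Fin 2) ℂ)),
                  PlaqSmall (θBal F.L γ b₀ p₀ J) U → PlaqSmall (θBal F.L γ b₀ p₀ J) V →
                  PlaqSmall (θBal F.L γ b₀ p₀ J) W → PlaqSmall (θBal F.L γ b₀ p₀ J) Z →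
                  (∀ e, e ≠ b → U e = V e) → (∀ e, e ≠ b' → U e = W e) → (∀ e, e ≠ b' → V e = Z e) → (∀ e, e ≠ b → W e = Z e) →
                  |((Real.log (ρ U) + (F.scheme ℰp γ).β K * minActionRegPr F J K hJK ε₀ U)
                      - (Real.log (ρ V) + (F.scheme ℰp γ).β K * minActionRegPr F J K hJK ε₀ V))
                    - ((Real.log (ρ W) + (F.scheme ℰp γ).β K * minActionRegPr F J K hJK ε₀ W)
                      - (Real.log (ρ Z) + (F.scheme ℰp γ).β K * minActionRegPr F J K hJK ε₀ Z))|
                    ≤ φ J * Real.exp (-(κ * (b.src.tdist b'.src : ℝ))) :=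
  fluctuationPartSmall_of_backgroundFormCell (backgroundFormCell_of_analytic hA)

/-- ★★★ **BGFORMᵃ∘ v2 → GRAD∘.**  Hypothesis = BGFORMᵃ∘ v2 (§1); conclusion = GRAD∘ `OneBondOscillationCan` (LINE g24-1 `Lines/gradient_split.lean` §0 VERBATIM):
`oneBondOscillation_of_backgroundFormCell ∘ backgroundFormCell_of_analytic`.
[cite: Balaban1987RG1, Thm 1 (0.24)-(0.25) p.257 and (1.11)-(1.14) p.262; Balaban1989LargeFieldII, (1.98)-(1.100) p.390; Balaban1985Variational, Prop. 9 p.309] -/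
theorem oneBondOscillation_of_backgroundFormCellAnalytic
    (hA :
        ∀ (L : ℕ), ∃ pS : ℝ, ∀ (b₀ p₀ : ℝ), 0 < b₀ → pS ≤ p₀ → 0 < p₀ → ∃ ε₁ : ℝ, 0 < ε₁ ∧ ∀ (ε₀ : ℝ), 0 < ε₀ → ε₀ ≤ ε₁ →
          ∃ γ₁ : ℝ, 0 < γ₁ ∧ ∃ (κ μ C A Hc Rₐ : ℝ), 0 < κ ∧ 0 ≤ μ ∧ 0 ≤ A ∧ 0 ≤ Hc ∧ 0 < Rₐ ∧ ∀ (F : T3Family) (γ : ℝ), F.L = L → 0 < γ → γ ≤ γ₁ →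
            ∃ (σ σ₂ : ℕ → ℝ), (∀ J, 0 ≤ σ J) ∧ (∀ J, 0 ≤ σ₂ J) ∧
              (∀ a : ℕ, Tendsto (fun J : ℕ => ((J : ℝ) + 1) ^ a * σ J) atTop (𝓝 0)) ∧
              (∀ a : ℕ, Tendsto (fun J : ℕ => ((J : ℝ) + 1) ^ a * σ₂ J) atTop (𝓝 0)) ∧
              ∀ (ν : ℕ → (j : ℕ) → Measure (GaugeField (F.P j) 0 (Matrix.specialUnitaryGroup (Fin 2) ℂ))),
                (∀ K, ν K K = T4GenFunBounds.gibbsMeasure (F.P K) ((F.scheme ℰp γ).β K)) →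
                (∀ K j, j < K → ν K j = Measure.map (descend F ℰp j) (ν K (j + 1))) →
                ∀ (J K : ℕ) (hJK : J ≤ K) (ρ : GaugeField (F.P J) 0 (Matrix.specialUnitaryGroup (Fin 2) ℂ) → ℝ),
                  (∀ U, PlaqSmall (θBal F.L γ b₀ p₀ J) U → 0 < ρ U) →
                  ν K J = (fieldMeasure _ _ _).withDensity (fun U => ENNReal.ofReal (ρ U)) →
                  ContinuousOn ρ {U | PlaqSmall (θBal F.L γ b₀ p₀ J) U} →
                  ∃ (c₀ : ℝ) (d : PBond (F.P J) 0 → PBond (F.P J) 0 → ℝ) (blk : PBond (F.P K) 0 → PBond (F.P J) 0)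
                    (M : GaugeField (F.P J) 0 (Matrix.specialUnitaryGroup (Fin 2) ℂ) → PBond (F.P K) 0 → (Fin 8 → ℝ))
                    (𝒯 : (X : Finset (PBond (F.P J) 0)) → (({e : PBond (F.P K) 0 // blk e ∈ X} → (Fin 8 → ℂ)) → ℂ))
                    (Dom : (X : Finset (PBond (F.P J) 0)) → Set ({e : PBond (F.P K) 0 // blk e ∈ X} → (Fin 8 → ℂ)))
                    (Bx : Finset (PBond (F.P J) 0) → ℝ),
                    (∀ x y, 0 ≤ d x y) ∧ (∀ x y, d x y = d y x) ∧ (∀ x y z, d x z ≤ d x y + d y z) ∧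
                    (∀ x, ∑ y, Real.exp (-(μ * d x y)) ≤ C) ∧
                    (∀ b b' : PBond (F.P J) 0, κ * (b.src.tdist b'.src : ℝ) ≤ μ * d b b') ∧
                    (∀ X, 0 ≤ Bx X) ∧
                    (∀ c, ∑ X ∈ Finset.univ.filter (fun X => c ∈ X), Bx X ≤ A) ∧
                    (∀ c c', ∑ X ∈ Finset.univ.filter (fun X => c ∈ X ∧ c' ∈ X), Bx X ≤ Hc * Real.exp (-(2 * μ * d c c'))) ∧
                    (∀ X, IsOpen (Dom X)) ∧ (∀ X, DifferentiableOn ℂ (𝒯 X) (Dom X)) ∧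
                    (∀ X, ∀ p ∈ Dom X, ‖𝒯 X p‖ ≤ Bx X) ∧
                    (∀ (X : Finset (PBond (F.P J) 0)) (U : GaugeField (F.P J) 0 (Matrix.specialUnitaryGroup (Fin 2) ℂ)),
                        PlaqSmall (θBal F.L γ b₀ p₀ J) U →
                        Metric.ball (fun (e : {e : PBond (F.P K) 0 // blk e ∈ X}) (i : Fin 8) => (M U e.1 i : ℂ)) (2 * Rₐ) ⊆ Dom X) ∧
                    (∀ (b : PBond (F.P J) 0) (U V : GaugeField (F.P J) 0 (Matrix.specialUnitaryGroup (Fin 2) ℂ)),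
                        PlaqSmall (θBal F.L γ b₀ p₀ J) U → PlaqSmall (θBal F.L γ b₀ p₀ J) V → (∀ e, e ≠ b → U e = V e) →
                        ∀ e, ‖M U e - M V e‖ ≤ σ J * Real.exp (-(2 * μ * d b (blk e)))) ∧
                    (∀ (b b' : PBond (F.P J) 0) (U V W Z : GaugeField (F.P J) 0 (Matrix.specialUnitaryGroup (Fin 2) ℂ)),
                        PlaqSmall (θBal F.L γ b₀ p₀ J) U → PlaqSmall (θBal F.L γ b₀ p₀ J) V →
                        PlaqSmall (θBal F.L γ b₀ p₀ J) W → PlaqSmall (θBal F.L γ b₀ p₀ J) Z →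
                        (∀ e, e ≠ b → U e = V e) → (∀ e, e ≠ b' → U e = W e) → (∀ e, e ≠ b' → V e = Z e) → (∀ e, e ≠ b → W e = Z e) →
                        ∀ e, ‖M U e - M W e - M V e + M Z e‖ ≤
                          σ₂ J * (Real.exp (-(2 * μ * d b (blk e))) * Real.exp (-(2 * μ * d (blk e) b')))) ∧
                    (∀ U : GaugeField (F.P J) 0 (Matrix.specialUnitaryGroup (Fin 2) ℂ), PlaqSmall (θBal F.L γ b₀ p₀ J) U →
                        Real.log (ρ U) + (F.scheme ℰp γ).β K * minActionRegPr F J K hJK ε₀ U = c₀ + ∑ X, (𝒯 X (fun (e : {e : PBond (F.P K) 0 // blk e ∈ X}) (i : Fin 8) => (M U e.1 i : ℂ))).re)) :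
      ∀ (L : ℕ), ∃ pS : ℝ, ∀ (b₀ p₀ : ℝ), 0 < b₀ → pS ≤ p₀ → 0 < p₀ → ∃ ε₁ : ℝ, 0 < ε₁ ∧ ∀ (ε₀ : ℝ), 0 < ε₀ → ε₀ ≤ ε₁ →
        ∃ γ₁ : ℝ, 0 < γ₁ ∧ ∀ (F : T3Family) (γ : ℝ), F.L = L → 0 < γ → γ ≤ γ₁ →
          ∃ (σ : ℕ → ℝ), (∀ J, 0 ≤ σ J) ∧ (∀ a : ℕ, Tendsto (fun J : ℕ => ((J : ℝ) + 1) ^ a * σ J) atTop (𝓝 0)) ∧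
            ∀ (ν : ℕ → (j : ℕ) → Measure (GaugeField (F.P j) 0 (Matrix.specialUnitaryGroup (Fin 2) ℂ))),
              (∀ K, ν K K = T4GenFunBounds.gibbsMeasure (F.P K) ((F.scheme ℰp γ).β K)) →
              (∀ K j, j < K → ν K j = Measure.map (descend F ℰp j) (ν K (j + 1))) →
              ∀ (J K : ℕ) (hJK : J ≤ K) (ρ : GaugeField (F.P J) 0 (Matrix.specialUnitaryGroup (Fin 2) ℂ) → ℝ),
                (∀ U, PlaqSmall (θBal F.L γ b₀ p₀ J) U → 0 < ρ U) →
                ν K J = (fieldMeasure _ _ _).withDensity (fun U => ENNReal.ofReal (ρ U)) →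
                ContinuousOn ρ {U | PlaqSmall (θBal F.L γ b₀ p₀ J) U} →
                ∀ (b : PBond (F.P J) 0) (U V : GaugeField (F.P J) 0 (Matrix.specialUnitaryGroup (Fin 2) ℂ)),
                  PlaqSmall (θBal F.L γ b₀ p₀ J) U → PlaqSmall (θBal F.L γ b₀ p₀ J) V →
                  (∀ e, e ≠ b → U e = V e) →
                  |(Real.log (ρ U) + (F.scheme ℰp γ).β K * minActionRegPr F J K hJK ε₀ U)
                      - (Real.log (ρ V) + (F.scheme ℰp γ).β K * minActionRegPr F J K hJK ε₀ V)| ≤ σ J :=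
  oneBondOscillation_of_backgroundFormCell (backgroundFormCell_of_analytic hA)

end Summit.QuantumFields.YangMills.Theorems.FluctuationComparisonRegPrIntLBackgroundFormCellAnalyticKnit
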